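import Summits.BirchSwinnertonDyer.BirchSwinnertonDyer.Theorems.Rank2ObservatoryListedSpan
import Summits.BirchSwinnertonDyer.BirchSwinnertonDyer.Theorems.Rank2ObservatoryRank3Witness
import Summits.BirchSwinnertonDyer.BirchSwinnertonDyer.Theorems.Rank2ObservatoryKernelWalker
import HarnessLib

/-!
# BirchSwinnertonDyer — rank ≥ 2 observatory: the rank-3 SATURATION certificate, I (Booleans)

HONEST FRAMING: per-curve certified theorems and census instruments; no claim on BSD in rank ≥ 2.

The rank-3 kernel certificates (`Rank2ObservatoryRank3Witness.lean`, per-curve files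
`Rank2ObservatoryRank3KernelCerts*`, census `three_le_mordellWeilRank_of_mem_rank3Table`) show
`3 ≤ rank_ℤ E(ℚ)` for all 9 487 rows of the rank-3 table from a torsion annihilator `2^u·m` and
seven coset witnesses modulo good primes. `Rank2ObservatoryListedSpan.lean` shows that the same
seven witnesses prove MORE: the listed span `ℤP₁ + ℤP₂ + ℤP₃ + E(ℚ)_tors` is `2`-SATURATED, hence
(given `rank_ℤ E(ℚ) = 3`) of finite ODD index — `Reg(P₁,P₂,P₃) = n² · Reg(E(ℚ)/tors)` with `n`
odd (Cremona 1997 §3.5, Siksek 1995). This file and its sequel `Rank2ObservatoryRank3SatCert.lean`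
turn the certificate into ONE kernel Boolean per row, so that the data can be TABULATED
(machine-written `Rank2ObservatoryRank3SatRows*` files, one `decide` per slice of rows) instead of
one theorem per curve. Here, the Booleans over an integral model and their soundness:

* the good-prime and killer Booleans `goodPrimeB`, `killerB`, `killers_of_all_killerB` are the
  rank-2 WALKER's (`Rank2ObservatoryKernelWalker.lean`, imported; primality by Mathlib's
  kernel-friendly `Nat.decidablePrime`); the witness prime is a DATUM and `q = 0` is rejected by
  pattern matching, so that `ZMod q` needs no `NeZero` instance;
* `witnessB` / `witness₂B` / `witness₃B` (good prime; chords `zmodChord` for sums; `cosetFreeB`)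
  with `not_mem_twoCoset_of_witnessB/₂B/₃B` (pull-back along `reduceMod`, exactly as inside
  `three_le_mordellWeilRank_of_kernelCert`);
* `twoSaturated_of_certB` — on an integral model the Booleans give `2`-saturation of the listed
  span (`listedSpan_two_saturated_of_not_mem_twoCoset`) AND `ℤ`-independence of the three
  integral points (`linearIndependent_triple_of_not_mem_twoCoset`).

Sorry-free; axioms `propext`, `Classical.choice`, `Quot.sound` only; no `native_decide`.

References: J. E. Cremona, *Algorithms for Modular Elliptic Curves* (2nd ed. 1997), §3.5 and
§2.4; S. Siksek, *Infinite descent on elliptic curves*, Rocky Mountain J. Math. 25 (1995)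
1501–1538; J. H. Silverman, *The Arithmetic of Elliptic Curves* (2nd ed. 2009), III.2.3,
Prop. VII.3.1(b), Thm. VIII.6.7.
-/

-- single-conjunct summit: `Summit.BirchSwinnertonDyer.BirchSwinnertonDyer.…` repeats the name
set_option linter.dupNamespace false

namespace Summit.BirchSwinnertonDyer.BirchSwinnertonDyer.Rank2Observatory

open WeierstrassCurve Literature.NumberTheory.EllipticCurves

/-! ### Good primes and killers

The Booleans `goodPrimeB V q` (`q` prime, `q ∤ Δ(V)`), `killerB V (ℓ, N)` (`ℓ` good and
`#Ẽ(𝔽_ℓ) = zmodPointCount V ℓ = N`) and the soundness theorem `killers_of_all_killerB` (the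
hypothesis `hS` of the torsion annihilator) are those of the rank-2 WALKER
(`Rank2ObservatoryKernelWalker.lean`), imported. -/

/-- Soundness of `goodPrimeB` (unfolded). [folklore] -/
private theorem goodPrimeB_spec {V : WeierstrassCurve ℤ} {q : ℕ} (h : goodPrimeB V q = true) :
    q.Prime ∧ ¬ (q : ℤ) ∣ V.Δ := by
  simpa only [goodPrimeB, Bool.and_eq_true, decide_eq_true_eq] using h

/-! ### Coset witnesses with the prime as a datum -/

/-- WITNESS for one point (a Boolean for `decide`): `q` good and `cosetFreeB V q u (X, Y) mod q`;
`q = 0` rejected. [cite: SilvermanAEC2009, III.2.3] -/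
def witnessB (V : WeierstrassCurve ℤ) (u : ℕ) : ℕ → ℤ → ℤ → Bool
  | 0, _, _ => false
  | q + 1, X, Y =>
      goodPrimeB V (q + 1) && cosetFreeB V (q + 1) u (X : ZMod (q + 1)) (Y : ZMod (q + 1))

/-- WITNESS for a sum of two points (a Boolean for `decide`): `q` good, the chord certificate
`zmodChord` for `(X₁,Y₁) + (X₂,Y₂) = (X₃,Y₃)` modulo `q`, and `cosetFreeB` for `(X₃,Y₃)`.
[cite: SilvermanAEC2009, III.2.3] -/
def witness₂B (V : WeierstrassCurve ℤ) (u : ℕ) : ℕ → ℤ → ℤ → ℤ → ℤ → ℤ → ℤ → Bool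
  | 0, _, _, _, _, _, _ => false
  | q + 1, X₁, Y₁, X₂, Y₂, X₃, Y₃ => goodPrimeB V (q + 1) &&
      zmodChord V (q + 1) (X₁ : ZMod (q + 1)) (Y₁ : ZMod (q + 1)) (X₂ : ZMod (q + 1))
        (Y₂ : ZMod (q + 1)) (X₃ : ZMod (q + 1)) (Y₃ : ZMod (q + 1)) &&
      cosetFreeB V (q + 1) u (X₃ : ZMod (q + 1)) (Y₃ : ZMod (q + 1))

/-- WITNESS for a sum of three points (a Boolean for `decide`): `q` good, two chord certificates
`(X₁,Y₁) + (X₂,Y₂) = (X₀,Y₀)`, `(X₀,Y₀) + (X₃,Y₃) = (X₄,Y₄)` modulo `q`, and `cosetFreeB` for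
`(X₄,Y₄)`. [cite: SilvermanAEC2009, III.2.3] -/
def witness₃B (V : WeierstrassCurve ℤ) (u : ℕ) :
    ℕ → ℤ → ℤ → ℤ → ℤ → ℤ → ℤ → ℤ → ℤ → ℤ → ℤ → Bool
  | 0, _, _, _, _, _, _, _, _, _, _ => false
  | q + 1, X₁, Y₁, X₂, Y₂, X₀, Y₀, X₃, Y₃, X₄, Y₄ => goodPrimeB V (q + 1) &&
      zmodChord V (q + 1) (X₁ : ZMod (q + 1)) (Y₁ : ZMod (q + 1)) (X₂ : ZMod (q + 1))
        (Y₂ : ZMod (q + 1)) (X₀ : ZMod (q + 1)) (Y₀ : ZMod (q + 1)) &&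
      zmodChord V (q + 1) (X₀ : ZMod (q + 1)) (Y₀ : ZMod (q + 1)) (X₃ : ZMod (q + 1))
        (Y₃ : ZMod (q + 1)) (X₄ : ZMod (q + 1)) (Y₄ : ZMod (q + 1)) &&
      cosetFreeB V (q + 1) u (X₄ : ZMod (q + 1)) (Y₄ : ZMod (q + 1))

section Soundness

variable {V : WeierstrassCurve ℤ} {u : ℕ}

/-- A passing witness names a good prime, so `Δ(V) ≠ 0`. [folklore] -/
theorem Δ_ne_zero_of_witnessB {q : ℕ} {X Y : ℤ} (hw : witnessB V u q X Y = true) : V.Δ ≠ 0 := by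
  cases q with
  | zero => simp [witnessB] at hw
  | succ q =>
    simp only [witnessB, Bool.and_eq_true] at hw
    exact Δ_ne_zero_of_not_dvd V (goodPrimeB_spec hw.1).2

/-- **Soundness of `witnessB`**: the integral point `(X, Y)` of `E(ℚ)` lies outside
`2E(ℚ) + E(ℚ)[2^u]` (reduce modulo the good prime `q`: `reduceMod_some`,
`not_mem_twoCoset_of_cosetFreeB`, pull back by `not_mem_twoCoset_of_map_not_mem`).
[cite: SilvermanAEC2009, Prop. VII.3.1(b)] -/
theorem not_mem_twoCoset_of_witnessB {q : ℕ} {X Y : ℤ} (hw : witnessB V u q X Y = true)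
    (hXY : V.toAffine.Equation X Y)
    (h : (V.map (Int.castRingHom ℚ)).toAffine.Nonsingular (X : ℚ) (Y : ℚ)) :
    (Affine.Point.some (X : ℚ) (Y : ℚ) h : (V.map (Int.castRingHom ℚ)).toAffine.Point) ∉
      twoCoset (V.map (Int.castRingHom ℚ)).toAffine.Point u := by
  classical
  cases q with
  | zero => simp [witnessB] at hw
  | succ q =>
    simp only [witnessB, Bool.and_eq_true] at hw
    obtain ⟨hg, hfree⟩ := hw
    obtain ⟨hp, hΔ⟩ := goodPrimeB_spec hg
    haveI : Fact (q + 1).Prime := ⟨hp⟩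
    refine not_mem_twoCoset_of_map_not_mem (reduceMod V (q + 1) hΔ) ?_
    rw [reduceMod_some V (q + 1) hΔ hXY]
    exact not_mem_twoCoset_of_cosetFreeB V (q + 1) hfree _

/-- **Soundness of `witness₂B`**: `(X₁, Y₁) + (X₂, Y₂) ∉ 2E(ℚ) + E(ℚ)[2^u]` (the sum is computed
after reduction by the certified chord, `exists_some_add_some_of_zmodChord`).
[cite: SilvermanAEC2009, Prop. VII.3.1(b)] -/
theorem not_mem_twoCoset_of_witness₂B {q : ℕ} {X₁ Y₁ X₂ Y₂ X₃ Y₃ : ℤ}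
    (hw : witness₂B V u q X₁ Y₁ X₂ Y₂ X₃ Y₃ = true)
    (e₁ : V.toAffine.Equation X₁ Y₁) (e₂ : V.toAffine.Equation X₂ Y₂)
    (h₁ : (V.map (Int.castRingHom ℚ)).toAffine.Nonsingular (X₁ : ℚ) (Y₁ : ℚ))
    (h₂ : (V.map (Int.castRingHom ℚ)).toAffine.Nonsingular (X₂ : ℚ) (Y₂ : ℚ)) :
    (Affine.Point.some (X₁ : ℚ) (Y₁ : ℚ) h₁ : (V.map (Int.castRingHom ℚ)).toAffine.Point) +
        Affine.Point.some (X₂ : ℚ) (Y₂ : ℚ) h₂ ∉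
      twoCoset (V.map (Int.castRingHom ℚ)).toAffine.Point u := by
  classical
  cases q with
  | zero => simp [witness₂B] at hw
  | succ q =>
    simp only [witness₂B, Bool.and_eq_true] at hw
    obtain ⟨⟨hg, hc⟩, hfree⟩ := hw
    obtain ⟨hp, hΔ⟩ := goodPrimeB_spec hg
    haveI : Fact (q + 1).Prime := ⟨hp⟩
    refine not_mem_twoCoset_of_map_not_mem (reduceMod V (q + 1) hΔ) ?_
    rw [map_add, reduceMod_some V (q + 1) hΔ e₁, reduceMod_some V (q + 1) hΔ e₂]
    obtain ⟨h', e⟩ := exists_some_add_some_of_zmodChord V (q + 1) _ _ hc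
    rw [e]
    exact not_mem_twoCoset_of_cosetFreeB V (q + 1) hfree _

/-- **Soundness of `witness₃B`**: `(X₁, Y₁) + (X₂, Y₂) + (X₃, Y₃) ∉ 2E(ℚ) + E(ℚ)[2^u]` (two
certified chords after reduction). [cite: SilvermanAEC2009, Prop. VII.3.1(b)] -/
theorem not_mem_twoCoset_of_witness₃B {q : ℕ} {X₁ Y₁ X₂ Y₂ X₀ Y₀ X₃ Y₃ X₄ Y₄ : ℤ}
    (hw : witness₃B V u q X₁ Y₁ X₂ Y₂ X₀ Y₀ X₃ Y₃ X₄ Y₄ = true)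
    (e₁ : V.toAffine.Equation X₁ Y₁) (e₂ : V.toAffine.Equation X₂ Y₂)
    (e₃ : V.toAffine.Equation X₃ Y₃)
    (h₁ : (V.map (Int.castRingHom ℚ)).toAffine.Nonsingular (X₁ : ℚ) (Y₁ : ℚ))
    (h₂ : (V.map (Int.castRingHom ℚ)).toAffine.Nonsingular (X₂ : ℚ) (Y₂ : ℚ))
    (h₃ : (V.map (Int.castRingHom ℚ)).toAffine.Nonsingular (X₃ : ℚ) (Y₃ : ℚ)) :
    (Affine.Point.some (X₁ : ℚ) (Y₁ : ℚ) h₁ : (V.map (Int.castRingHom ℚ)).toAffine.Point) +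
        Affine.Point.some (X₂ : ℚ) (Y₂ : ℚ) h₂ + Affine.Point.some (X₃ : ℚ) (Y₃ : ℚ) h₃ ∉
      twoCoset (V.map (Int.castRingHom ℚ)).toAffine.Point u := by
  classical
  cases q with
  | zero => simp [witness₃B] at hw
  | succ q =>
    simp only [witness₃B, Bool.and_eq_true] at hw
    obtain ⟨⟨⟨hg, hc⟩, hc'⟩, hfree⟩ := hw
    obtain ⟨hp, hΔ⟩ := goodPrimeB_spec hg
    haveI : Fact (q + 1).Prime := ⟨hp⟩
    refine not_mem_twoCoset_of_map_not_mem (reduceMod V (q + 1) hΔ) ?_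
    rw [map_add, map_add, reduceMod_some V (q + 1) hΔ e₁, reduceMod_some V (q + 1) hΔ e₂,
      reduceMod_some V (q + 1) hΔ e₃]
    obtain ⟨h', e⟩ := exists_some_add_some_of_zmodChord V (q + 1) _ _ hc
    rw [e]
    obtain ⟨h'', e'⟩ := exists_some_add_some_of_zmodChord V (q + 1) _ _ hc'
    rw [e']
    exact not_mem_twoCoset_of_cosetFreeB V (q + 1) hfree _

end Soundness

/-! ### The certificate on an integral model -/

/-- **The saturation certificate on an integral model.** Three integral points `(Xᵢ, Yᵢ)` on `V`
(`Δ ≠ 0`); annihilator `t = 2^u·m`, `m` odd, certified by `annihilatorCheck S t` with all of `S`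
passing `killerB`; seven witnesses (`witnessB` ×3, `witness₂B` ×3, `witness₃B`). Then in
`E(ℚ) = (V over ℚ)⟮ℚ⟯` the listed span `ℤP₁ + ℤP₂ + ℤP₃ + E(ℚ)_tors` is `2`-saturated
(`listedSpan_two_saturated_of_not_mem_twoCoset`) and `P₁, P₂, P₃` are `ℤ`-independent
(`linearIndependent_triple_of_not_mem_twoCoset`).
[cite: CremonaAlgorithms1997, §3.5] [cite: SilvermanAEC2009, Prop. VII.3.1(b)] -/
theorem twoSaturated_of_certB (V : WeierstrassCurve ℤ) (hΔ : V.Δ ≠ 0) {X₁ Y₁ X₂ Y₂ X₃ Y₃ : ℤ}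
    (e₁ : Y₁ ^ 2 + V.a₁ * X₁ * Y₁ + V.a₃ * Y₁ = X₁ ^ 3 + V.a₂ * X₁ ^ 2 + V.a₄ * X₁ + V.a₆)
    (e₂ : Y₂ ^ 2 + V.a₁ * X₂ * Y₂ + V.a₃ * Y₂ = X₂ ^ 3 + V.a₂ * X₂ ^ 2 + V.a₄ * X₂ + V.a₆)
    (e₃ : Y₃ ^ 2 + V.a₁ * X₃ * Y₃ + V.a₃ * Y₃ = X₃ ^ 3 + V.a₂ * X₃ ^ 2 + V.a₄ * X₃ + V.a₆)
    {S : List (ℕ × ℕ)} {t u m : ℕ} (hm : m % 2 = 1) (htm : t = 2 ^ u * m)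
    (hann : annihilatorCheck S t = true) (hS : S.all (killerB V) = true)
    {q₁ q₂ q₃ q₁₂ q₁₃ q₂₃ q₁₂₃ : ℕ} {X₁₂ Y₁₂ X₁₃ Y₁₃ X₂₃ Y₂₃ X₀ Y₀ X₁₂₃ Y₁₂₃ : ℤ}
    (hw₁ : witnessB V u q₁ X₁ Y₁ = true) (hw₂ : witnessB V u q₂ X₂ Y₂ = true)
    (hw₃ : witnessB V u q₃ X₃ Y₃ = true)
    (hw₁₂ : witness₂B V u q₁₂ X₁ Y₁ X₂ Y₂ X₁₂ Y₁₂ = true)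
    (hw₁₃ : witness₂B V u q₁₃ X₁ Y₁ X₃ Y₃ X₁₃ Y₁₃ = true)
    (hw₂₃ : witness₂B V u q₂₃ X₂ Y₂ X₃ Y₃ X₂₃ Y₂₃ = true)
    (hw₁₂₃ : witness₃B V u q₁₂₃ X₁ Y₁ X₂ Y₂ X₀ Y₀ X₃ Y₃ X₁₂₃ Y₁₂₃ = true) :
    (∀ a : (V.map (Int.castRingHom ℚ)).toAffine.Point,
      2 • a ∈ AddSubgroup.closure
          {Affine.Point.some (X₁ : ℚ) (Y₁ : ℚ) (nonsingular_rat_of_eq V hΔ e₁),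
            Affine.Point.some (X₂ : ℚ) (Y₂ : ℚ) (nonsingular_rat_of_eq V hΔ e₂),
            Affine.Point.some (X₃ : ℚ) (Y₃ : ℚ) (nonsingular_rat_of_eq V hΔ e₃)} ⊔
          AddCommGroup.torsion _ →
      a ∈ AddSubgroup.closure
          {Affine.Point.some (X₁ : ℚ) (Y₁ : ℚ) (nonsingular_rat_of_eq V hΔ e₁),
            Affine.Point.some (X₂ : ℚ) (Y₂ : ℚ) (nonsingular_rat_of_eq V hΔ e₂),
            Affine.Point.some (X₃ : ℚ) (Y₃ : ℚ) (nonsingular_rat_of_eq V hΔ e₃)} ⊔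
          AddCommGroup.torsion _) ∧
    LinearIndependent ℤ
      ![(Affine.Point.some (X₁ : ℚ) (Y₁ : ℚ) (nonsingular_rat_of_eq V hΔ e₁) :
          (V.map (Int.castRingHom ℚ)).toAffine.Point),
        Affine.Point.some (X₂ : ℚ) (Y₂ : ℚ) (nonsingular_rat_of_eq V hΔ e₂),
        Affine.Point.some (X₃ : ℚ) (Y₃ : ℚ) (nonsingular_rat_of_eq V hΔ e₃)] := by
  classical
  have hm' : Odd (m : ℤ) := by exact_mod_cast Nat.odd_iff.mpr hm
  have htm' : (t : ℤ) = 2 ^ u * (m : ℤ) := by rw [htm]; push_cast; ring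
  have hK := killers_of_all_killerB V hS
  have htors : ∀ x : (V.map (Int.castRingHom ℚ)).toAffine.Point, IsOfFinAddOrder x →
      ((2 : ℤ) ^ u * (m : ℤ)) • x = 0 :=
    fun x hx => zsmul_eq_zero_of_annihilatorCheck hK hann htm' x hx
  have E₁ : V.toAffine.Equation X₁ Y₁ := (Affine.equation_iff X₁ Y₁).mpr e₁
  have E₂ : V.toAffine.Equation X₂ Y₂ := (Affine.equation_iff X₂ Y₂).mpr e₂
  have E₃ : V.toAffine.Equation X₃ Y₃ := (Affine.equation_iff X₃ Y₃).mpr e₃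
  have h₁ := not_mem_twoCoset_of_witnessB hw₁ E₁ (nonsingular_rat_of_eq V hΔ e₁)
  have h₂ := not_mem_twoCoset_of_witnessB hw₂ E₂ (nonsingular_rat_of_eq V hΔ e₂)
  have h₃ := not_mem_twoCoset_of_witnessB hw₃ E₃ (nonsingular_rat_of_eq V hΔ e₃)
  have h₁₂ := not_mem_twoCoset_of_witness₂B hw₁₂ E₁ E₂ (nonsingular_rat_of_eq V hΔ e₁)
    (nonsingular_rat_of_eq V hΔ e₂)
  have h₁₃ := not_mem_twoCoset_of_witness₂B hw₁₃ E₁ E₃ (nonsingular_rat_of_eq V hΔ e₁)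
    (nonsingular_rat_of_eq V hΔ e₃)
  have h₂₃ := not_mem_twoCoset_of_witness₂B hw₂₃ E₂ E₃ (nonsingular_rat_of_eq V hΔ e₂)
    (nonsingular_rat_of_eq V hΔ e₃)
  have h₁₂₃ := not_mem_twoCoset_of_witness₃B hw₁₂₃ E₁ E₂ E₃ (nonsingular_rat_of_eq V hΔ e₁)
    (nonsingular_rat_of_eq V hΔ e₂) (nonsingular_rat_of_eq V hΔ e₃)
  exact ⟨listedSpan_two_saturated_of_not_mem_twoCoset hm' htors h₁ h₂ h₃ h₁₂ h₁₃ h₂₃ h₁₂₃,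
    linearIndependent_triple_of_not_mem_twoCoset hm' htors h₁ h₂ h₃ h₁₂ h₁₃ h₂₃ h₁₂₃⟩

end Summit.BirchSwinnertonDyer.BirchSwinnertonDyer.Rank2Observatory
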